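import Summits.Ventures.PercRepro.C025ProfileRankFourLemmas

/-!
# The rank-4 certificate: (Dem)(d), the per-superset facts for a pair on a long line (night-3 g8)

NIGHT3-G7-RANK4-CERTIFICATE.md §2(d): a pair `B` with `j(B) = 2` — its line `L = cl B` has `t ≥ 2` further points,
`T := L ∖ B` — in a simple matroid of rank `4` has `p = ρ(E∖B) = 4` (F4) and `f := |F| ≥ 2` for `F := E ∖ L`. Its paying
supersets are the three-sets `B ∪ {y}` (`y ∈ F`), worth `3/2` when `ρ(E ∖ (B ∪ y)) = 3` and `1` otherwise, and the
four-sets `B ∪ {z, y}` (`z ∈ T`, `y ∈ F`), worth `1/4, 1/6, 1/9` by `r = ρ(E ∖ (B ∪ {z, y})) ∈ {2, 3, 4}`. This module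
proves the per-superset facts: membership in the level, the values, `2 ≤ r ≤ min(2, t − 1) + (f − 1)`, and `r = 3`
for the three-sets when `f = 2`. The sums are assembled in `C025ProfileRankFourDemD`.
-/

open scoped Matroid

namespace PercRepro

open Set Finset ThmH

section DemDA

variable {α : Type} [DecidableEq α] {M : Matroid α} [M.Finite]

/-- Lower bounds on the four-set value `1/4, 1/6, 1/9` (at `r = 2, 3, 4`) for `2 ≤ r ≤ 4` from an upper bound `r ≤ m`. -/
theorem wr_ge {r m : ℕ} (h2 : 2 ≤ r) (h4 : r ≤ 4) (hm : r ≤ m) :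
    (m ≤ 2 → 1 / 4 ≤ (if r = 2 then (1 / 4 : ℚ) else if r = 3 then 1 / 6 else if r = 4 then 1 / 9 else 0)) ∧
    (m ≤ 3 → 1 / 6 ≤ (if r = 2 then (1 / 4 : ℚ) else if r = 3 then 1 / 6 else if r = 4 then 1 / 9 else 0)) ∧
    1 / 9 ≤ (if r = 2 then (1 / 4 : ℚ) else if r = 3 then 1 / 6 else if r = 4 then 1 / 9 else 0) := by
  refine ⟨fun hm2 => ?_, fun hm3 => ?_, ?_⟩
  · have : r = 2 := by omega
    rw [if_pos this]
  · rcases Nat.lt_or_ge r 3 with h | h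
    · have : r = 2 := by omega
      rw [if_pos this]; norm_num
    · have : r = 3 := by omega
      rw [if_neg (by omega), if_pos this]
  · rcases Nat.lt_or_ge r 3 with h | h
    · have : r = 2 := by omega
      rw [if_pos this]; norm_num
    · rcases Nat.lt_or_ge r 4 with h' | h'
      · have : r = 3 := by omega
        rw [if_neg (by omega), if_pos this]; norm_num
      · have : r = 4 := by omega
        rw [if_neg (by omega), if_neg (by omega), if_pos this]

/-- The points outside the line of `B` are outside `B`, outside `T = cl B ∖ B`, and not in the closure of `B`. -/
theorem mem_F_facts {B : Finset α} (hBg : B ⊆ gr M) {y : α} (hy : y ∈ gr M \ clF M B) :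
    y ∈ gr M ∧ y ∉ clF M B ∧ y ∉ B ∧ y ∉ M.closure (B : Set α) := by
  rw [Finset.mem_sdiff] at hy
  refine ⟨hy.1, hy.2, fun h => hy.2 (subset_clF_self hBg h), fun h => hy.2 ?_⟩
  rw [← Finset.mem_coe, coe_clF]; exact h

/-- A three-set `B ∪ {y}` over a rank-`2` set `B` with `y` outside its line is in the level `3`. -/
theorem insert_mem_filter_of_mem_F {B : Finset α} (hB : B ∈ Profile.Rq M 2) {y : α} (hy : y ∈ gr M \ clF M B) :
    insert y B ∈ (Shadow.levelSet M 3).filter (fun S => B ⊆ S) := by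
  rw [Profile.mem_Rq] at hB
  obtain ⟨hyg, _, _, hycl⟩ := mem_F_facts hB.1 hy
  have hyE : y ∈ M.E := by rw [← coe_gr]; exact_mod_cast hyg
  rw [Finset.mem_filter, Profile.mem_levelSet]
  refine ⟨⟨Finset.insert_subset hyg hB.1, ?_⟩, Finset.subset_insert _ _⟩
  rw [Finset.coe_insert, M.eRk_insert_eq_add_one ⟨hyE, hycl⟩, hB.2]; rfl

/-- A four-set `B ∪ {z, y}` (`z` on the line of `B` outside `B`, `y` off the line) is in the level `3`. -/
theorem insert_insert_mem_filter_of_mem_T_F {B : Finset α} (hB : B ∈ Profile.Rq M 2) {z y : α}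
    (hz : z ∈ clF M B \ B) (hy : y ∈ gr M \ clF M B) :
    insert y (insert z B) ∈ (Shadow.levelSet M 3).filter (fun S => B ⊆ S) := by
  rw [Profile.mem_Rq] at hB
  obtain ⟨hyg, hyL, _, _⟩ := mem_F_facts hB.1 hy
  have hyE : y ∈ M.E := by rw [← coe_gr]; exact_mod_cast hyg
  have hzL : z ∈ clF M B := (Finset.mem_sdiff.1 hz).1
  have hzg : z ∈ gr M := clF_subset_gr B hzL
  -- B ∪ {z} has rank 2: it lies in cl B
  have hsub : ((insert z B : Finset α) : Set α) ⊆ M.closure (B : Set α) := by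
    rw [Finset.coe_insert]
    refine Set.insert_subset ?_ (M.subset_closure _ (by rw [← coe_gr]; exact_mod_cast hB.1))
    rw [← Finset.mem_coe, coe_clF] at hzL; exact hzL
  have hcl : M.closure ((insert z B : Finset α) : Set α) = M.closure (B : Set α) := by
    apply Set.Subset.antisymm (M.closure_subset_closure_of_subset_closure hsub)
    exact M.closure_subset_closure (by rw [Finset.coe_insert]; exact Set.subset_insert _ _)
  have hrk : M.eRk ((insert z B : Finset α) : Set α) = 2 := by
    rw [← M.eRk_closure_eq, hcl, M.eRk_closure_eq, hB.2]; rfl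
  have hycl' : y ∉ M.closure ((insert z B : Finset α) : Set α) := by
    rw [hcl, ← coe_clF]; exact_mod_cast hyL
  rw [Finset.mem_filter, Profile.mem_levelSet]
  refine ⟨⟨Finset.insert_subset hyg (Finset.insert_subset hzg hB.1), ?_⟩,
    (Finset.subset_insert _ _).trans (Finset.subset_insert _ _)⟩
  rw [Finset.coe_insert, M.eRk_insert_eq_add_one ⟨hyE, hycl'⟩, hrk]; rfl

/-- The complement of the four-set `B ∪ {z, y}`: `(T ∖ z) ∪ (F ∖ y)`. -/
theorem gr_sdiff_insert_insert_eq {B : Finset α} (hBg : B ⊆ gr M) {z y : α} (hz : z ∈ clF M B \ B)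
    (hy : y ∈ gr M \ clF M B) :
    gr M \ insert y (insert z B) = (clF M B \ B).erase z ∪ (gr M \ clF M B).erase y := by
  obtain ⟨hyg, hyL, hyB, _⟩ := mem_F_facts hBg hy
  ext x
  simp only [Finset.mem_sdiff, Finset.mem_insert, Finset.mem_union, Finset.mem_erase, not_or]
  constructor
  · rintro ⟨hx, hxy, hxz, hxB⟩
    by_cases hc : x ∈ clF M B
    · exact Or.inl ⟨hxz, hc, hxB⟩
    · exact Or.inr ⟨hxy, hx, hc⟩
  · rintro (⟨hxz, hxL, hxB⟩ | ⟨hxy, hxg, hxL⟩)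
    · refine ⟨clF_subset_gr B hxL, ?_, hxz, hxB⟩
      rintro rfl; exact hyL hxL
    · exact ⟨hxg, hxy, fun h => hxL (by rw [h]; exact (Finset.mem_sdiff.1 hz).1), fun h => hxL (subset_clF_self hBg h)⟩

/-- The complement of the three-set `B ∪ {y}`: `T ∪ (F ∖ y)`. -/
theorem gr_sdiff_insert_eq {B : Finset α} (hBg : B ⊆ gr M) {y : α} (hy : y ∈ gr M \ clF M B) :
    gr M \ insert y B = (clF M B \ B) ∪ (gr M \ clF M B).erase y := by
  obtain ⟨hyg, hyL, hyB, _⟩ := mem_F_facts hBg hy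
  ext x
  simp only [Finset.mem_sdiff, Finset.mem_insert, Finset.mem_union, Finset.mem_erase, not_or]
  constructor
  · rintro ⟨hx, hxy, hxB⟩
    by_cases hc : x ∈ clF M B
    · exact Or.inl ⟨hc, hxB⟩
    · exact Or.inr ⟨hxy, hx, hc⟩
  · rintro (⟨hxL, hxB⟩ | ⟨hxy, hxg, hxL⟩)
    · refine ⟨clF_subset_gr B hxL, ?_, hxB⟩
      rintro rfl; exact hyL hxL
    · exact ⟨hxg, hxy, fun h => hxL (subset_clF_self hBg h)⟩

/-- The value of the rule on a four-set over a pair with `j = 2` and `ρ(E∖B) = 4`. -/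
theorem w4n_insert_insert_eq_wr {B : Finset α} (hBg : B ⊆ gr M) (hBc : B.card = 2) (hj : jB M B = 2)
    (hp4 : crk M B = 4) {z y : α} (hz : z ∈ clF M B \ B) (hy : y ∈ gr M \ clF M B) :
    w4n M B (insert y (insert z B)) =
      (if crk M (insert y (insert z B)) = 2 then (1 / 4 : ℚ) else if crk M (insert y (insert z B)) = 3 then 1 / 6
       else if crk M (insert y (insert z B)) = 4 then 1 / 9 else 0) := by
  obtain ⟨hyg, hyL, hyB, _⟩ := mem_F_facts hBg hy
  have hzB : z ∉ B := (Finset.mem_sdiff.1 hz).2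
  have hyz : y ≠ z := by rintro rfl; exact hyL (Finset.mem_sdiff.1 hz).1
  have hsd : (insert y (insert z B) \ B).card = 2 := by
    rw [Finset.insert_sdiff_of_notMem _ hyB, Finset.insert_sdiff_of_notMem _ hzB, Finset.sdiff_self,
      Finset.insert_empty, Finset.card_pair hyz]
  unfold w4n
  rw [w4_of_sdiff_card_two_of_card_two hsd hBc (by omega), if_neg (by rw [hj]; omega), if_pos ⟨hj, hp4⟩]
  apply max_eq_right
  split_ifs <;> norm_num

/-- The value of the rule on a three-set over a pair with `j = 2` and `ρ(E∖B) = 4`: `3/2` if the complement has rank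
`3`, else `1`. -/
theorem w4n_insert_eq_of_jB_eq_two {B : Finset α} (hBg : B ⊆ gr M) (hBc : B.card = 2) (hj : jB M B = 2)
    (hp4 : crk M B = 4) {y : α} (hy : y ∈ gr M \ clF M B) :
    w4n M B (insert y B) = (if crk M (insert y B) = 3 then 3 / 2 else 1) := by
  obtain ⟨hyg, hyL, hyB, _⟩ := mem_F_facts hBg hy
  have hsd : (insert y B \ B).card = 1 := by
    rw [Finset.insert_sdiff_of_notMem _ hyB, Finset.sdiff_self, Finset.insert_empty, Finset.card_singleton]
  unfold w4n
  rw [w4_of_sdiff_card_one_of_card_two hsd hBc (by omega), if_neg (by rw [hj]; omega), if_neg (by rw [hj]; omega)]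
  have : (crk M (insert y B) + 1 = crk M B) ↔ (crk M (insert y B) = 3) := by rw [hp4]; omega
  simp only [this]
  apply max_eq_right
  split_ifs <;> norm_num

/-- The complement rank of a four-set `B ∪ {z, y}` is at least `2` (when `T` and `F` have other points) and at most
`min(2, t − 1) + (f − 1)`. -/
theorem crk_insert_insert_bounds (hsimple : ∀ T ⊆ M.E, T.encard ≤ 2 → M.Indep T) {B : Finset α}
    (hB : B ∈ Profile.Rq M 2) {z y : α} (hz : z ∈ clF M B \ B) (hy : y ∈ gr M \ clF M B)
    (hT2 : 2 ≤ (clF M B \ B).card) (hF2 : 2 ≤ (gr M \ clF M B).card) :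
    2 ≤ crk M (insert y (insert z B)) ∧
      crk M (insert y (insert z B)) ≤ min 2 ((clF M B \ B).card - 1) + ((gr M \ clF M B).card - 1) := by
  rw [Profile.mem_Rq] at hB
  obtain ⟨hBg, hB2⟩ := hB
  have hcompl := gr_sdiff_insert_insert_eq hBg hz hy
  set T := clF M B \ B with hT
  set F := gr M \ clF M B with hF
  have hTg : T ⊆ gr M := Finset.sdiff_subset.trans (clF_subset_gr B)
  have hFg : F ⊆ gr M := Finset.sdiff_subset
  -- the rank in ℕ∞
  have hE : M.eRk ((gr M \ insert y (insert z B) : Finset α) : Set α) = (crk M (insert y (insert z B)) : ℕ∞) :=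
    eRk_gr_sdiff_eq_crk _
  constructor
  · -- two distinct points z' ∈ T ∖ z and y' ∈ F ∖ y lie in the complement
    have hTz : 1 ≤ (T.erase z).card := by rw [Finset.card_erase_of_mem hz]; omega
    have hFy : 1 ≤ (F.erase y).card := by rw [Finset.card_erase_of_mem hy]; omega
    obtain ⟨z', hz'⟩ := Finset.card_pos.1 hTz
    obtain ⟨y', hy'⟩ := Finset.card_pos.1 hFy
    have hz'T : z' ∈ T := (Finset.mem_erase.1 hz').2
    have hy'F : y' ∈ F := (Finset.mem_erase.1 hy').2
    have hne : z' ≠ y' := by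
      rintro rfl
      exact (Finset.mem_sdiff.1 hy'F).2 (Finset.mem_sdiff.1 hz'T).1
    have h2 : (2 : ℕ∞) ≤ M.eRk ((gr M \ insert y (insert z B) : Finset α) : Set α) := by
      apply two_le_eRk_of_pair_subset hsimple Finset.sdiff_subset (a := z') (b := y') _ _ hne
      · rw [hcompl, Finset.mem_union]; exact Or.inl hz'
      · rw [hcompl, Finset.mem_union]; exact Or.inr hy'
    rw [hE] at h2
    exact_mod_cast h2
  · -- submodularity: ρ((T∖z) ∪ (F∖y)) ≤ ρ(T∖z) + ρ(F∖y)
    have hTr : M.eRk ((T.erase z : Finset α) : Set α) ≤ ((min 2 (T.card - 1) : ℕ) : ℕ∞) := by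
      have h1 : M.eRk ((T.erase z : Finset α) : Set α) ≤ 2 := by
        calc M.eRk ((T.erase z : Finset α) : Set α) ≤ M.eRk ((clF M B : Finset α) : Set α) :=
              M.eRk_mono (Finset.coe_subset.2 ((Finset.erase_subset _ _).trans Finset.sdiff_subset))
          _ = 2 := eRk_clF_of_eRk_two hB2
      have h2 : M.eRk ((T.erase z : Finset α) : Set α) ≤ ((T.card - 1 : ℕ) : ℕ∞) := by
        rw [← Finset.card_erase_of_mem hz, ← Set.encard_coe_eq_coe_finsetCard]; exact M.eRk_le_encard _
      rcases le_or_gt 2 (T.card - 1) with h | h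
      · rw [min_eq_left h]; exact h1
      · rw [min_eq_right h.le]; exact h2
    have hFr : M.eRk ((F.erase y : Finset α) : Set α) ≤ ((F.card - 1 : ℕ) : ℕ∞) := by
      rw [← Finset.card_erase_of_mem hy, ← Set.encard_coe_eq_coe_finsetCard]; exact M.eRk_le_encard _
    have h : M.eRk ((gr M \ insert y (insert z B) : Finset α) : Set α) ≤
        ((min 2 (T.card - 1) : ℕ) : ℕ∞) + ((F.card - 1 : ℕ) : ℕ∞) := by
      rw [hcompl, Finset.coe_union]
      calc M.eRk ((T.erase z : Finset α) ∪ (F.erase y : Finset α) : Set α)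
          ≤ M.eRk ((T.erase z : Finset α) : Set α) + M.eRk ((F.erase y : Finset α) : Set α) :=
            M.eRk_union_le_eRk_add_eRk _ _
        _ ≤ ((min 2 (T.card - 1) : ℕ) : ℕ∞) + ((F.card - 1 : ℕ) : ℕ∞) := add_le_add hTr hFr
    rw [hE] at h
    exact_mod_cast h

/-- When `F = {y, y'}` has exactly two points, the three-set `B ∪ {y}` has complement `T ∪ {y'}` of rank exactly `3`
(`T` spans the line, `y'` is off it). -/
theorem crk_insert_eq_three_of_card_F_two (hsimple : ∀ T ⊆ M.E, T.encard ≤ 2 → M.Indep T) {B : Finset α}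
    (hB : B ∈ Profile.Rq M 2) (hj : jB M B = 2) {y : α} (hy : y ∈ gr M \ clF M B)
    (hF2 : (gr M \ clF M B).card = 2) : crk M (insert y B) = 3 := by
  have hBmem := hB
  rw [Profile.mem_Rq] at hB
  obtain ⟨hBg, hB2⟩ := hB
  have hcompl := gr_sdiff_insert_eq hBg hy
  set T := clF M B \ B with hT
  set F := gr M \ clF M B with hF
  -- F ∖ y = {y'}
  have hFy : (F.erase y).card = 1 := by rw [Finset.card_erase_of_mem hy, hF2]
  obtain ⟨y', hy'⟩ := Finset.card_eq_one.1 hFy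
  have hy'F : y' ∈ F := (Finset.mem_erase.1 (by rw [hy']; exact Finset.mem_singleton_self y')).2
  have hy'E : y' ∈ M.E := by rw [← coe_gr]; exact_mod_cast (Finset.mem_sdiff.1 hy'F).1
  have hy'L : y' ∉ clF M B := (Finset.mem_sdiff.1 hy'F).2
  -- T has rank 2 (at least two points of the line, inside the line)
  have hTr : M.eRk ((T : Finset α) : Set α) = 2 := by
    apply le_antisymm
    · calc M.eRk ((T : Finset α) : Set α) ≤ M.eRk ((clF M B : Finset α) : Set α) :=
            M.eRk_mono (Finset.coe_subset.2 Finset.sdiff_subset)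
        _ = 2 := eRk_clF_of_eRk_two hB2
    · have := jB_le_eRk_clF_sdiff hsimple hBg
      rw [hj] at this
      exact_mod_cast this
  -- y' is not in the closure of T
  have hy'cl : y' ∉ M.closure ((T : Finset α) : Set α) := by
    intro h
    apply hy'L
    rw [← Finset.mem_coe, coe_clF]
    have hsub : M.closure ((T : Finset α) : Set α) ⊆ M.closure (B : Set α) := by
      calc M.closure ((T : Finset α) : Set α) ⊆ M.closure ((clF M B : Finset α) : Set α) :=
            M.closure_subset_closure (Finset.coe_subset.2 Finset.sdiff_subset)
        _ = M.closure (B : Set α) := by rw [coe_clF, M.closure_closure]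
    exact hsub h
  have h3 : M.eRk ((gr M \ insert y B : Finset α) : Set α) = 3 := by
    rw [hcompl, hy', Finset.coe_union, Finset.coe_singleton, Set.union_singleton,
      M.eRk_insert_eq_add_one ⟨hy'E, hy'cl⟩, hTr]
    rfl
  rw [eRk_gr_sdiff_eq_crk] at h3
  exact_mod_cast h3

end DemDA

end PercRepro
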